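import Mathlib.RingTheory.MvPowerSeries.Rename
import Mathlib.RingTheory.MvPowerSeries.Equiv
import Mathlib.RingTheory.MvPowerSeries.Inverse
import Mathlib.RingTheory.MvPowerSeries.NoZeroDivisors
import Mathlib.RingTheory.MvPowerSeries.Order
import Mathlib.RingTheory.PowerSeries.Inverse
import Mathlib.RingTheory.MvPolynomial.Basic
import Mathlib.RingTheory.MvPolynomial.WeightedHomogeneous
import Mathlib.Algebra.CharP.Algebra
import Mathlib.Algebra.CharP.Lemmas
import HarnessLib

/-!
# Two-variable formal power series: killing a variable, first-order coefficients, leading forms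

Topic: `Literature/RingTheory/TwoVariableSeries`. Elementary bookkeeping in `F[[X₀, X₁]]`
(`MvPowerSeries (Fin 2) F`) used by the discharge of Cutkosky's Lemma 3.1
(`Literature.Barriers.ResolutionOfSingularities.Cutkosky.CutkoskyLemma31`), where the completion
`B̂ = k[[x, y]]` of a two-dimensional regular local ring is manipulated through "set `x = 0`",
"the coefficient of `x`", "`x` divides", and leading forms. This file holds the DEFINITIONS of the
sub-topic (`killVar`, `leadingForm`, `wt`, `lineForm`) with their unfolding lemmas; the theory is
in the sibling files `LeadingForm.lean`, `NoCancellation.lean`.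

* `killVar k : F[[X₀,X₁]] →ₐ[F] F[[t]]` — kill the variable `X k`, keep the other one as `t`
  (Mathlib's `MvPowerSeries.killCompl` along `Unit ↪ Fin 2`); its kernel is `(X k)`
  (`killVar_eq_zero_iff`), so it detects divisibility by a variable;
* cancellation: an element `w` with `w(0) = 0` whose restrictions to both axes are nonzero divides
  no `X₀ᵃ X₁ᵇ · unit` (`not_dvd_X_pow_mul_X_pow_mul`);
* the first-order coefficients `coeff (single k 1)` satisfy the Leibniz rule at the origin and kill
  `p`-th powers in characteristic `p`;
* `CharP` for `MvPowerSeries`/`PowerSeries` over a ring of characteristic `p` (as theorems, to be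
  introduced with `haveI`);
* `leadingForm f` — the homogeneous component of degree `ord f` (Cutkosky, Math. Ann. 362 (2015),
  §3: "define the leading form of `F` to be `L(F) = Σ_{i+j=r} a_{ij} xⁱ yʲ` if `ord(F) = r`");
* `lineForm q h d = Σ_{n₀ j + n₁ k = d} h_{jk} L(q₀)ʲ L(q₁)ᵏ` — the candidate leading form of a
  polynomial expression `h(q₀, q₁)` in weighted degree `d` (weights `wt q = (ord q₀, ord q₁)`).

Everything here is [folklore].
-/

noncomputable section

namespace Literature.RingTheory.TwoVariableSeries

open _root_.MvPowerSeries

universe u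

/-! ## Indices -/

/-- In `Fin 2` every index is `j` or `j.rev`. [folklore] -/
theorem fin2_eq_or_eq_rev (i j : Fin 2) : i = j ∨ i = j.rev := by
  revert i j; decide

/-- `j.rev ≠ j` in `Fin 2`. [folklore] -/
theorem fin2_rev_ne (j : Fin 2) : j.rev ≠ j := by
  revert j; decide

/-- A finitely supported function on `Fin 2` vanishing at `j.rev` is a single at `j`. [folklore] -/
theorem finsupp_eq_single_of_rev_eq_zero {m : Fin 2 →₀ ℕ} {j : Fin 2} (h : m j.rev = 0) :
    m = Finsupp.single j (m j) := by
  ext i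
  rcases fin2_eq_or_eq_rev i j with rfl | rfl
  · rw [Finsupp.single_eq_same]
  · rw [h, Finsupp.single_eq_of_ne (fin2_rev_ne _)]

/-- The values at `0` and `1` determine a finitely supported function on `Fin 2`. [folklore] -/
theorem finsupp_fin2_ext {m n : Fin 2 →₀ ℕ} (h0 : m 0 = n 0) (h1 : m 1 = n 1) : m = n := by
  ext i
  fin_cases i
  · exact h0
  · exact h1

/-! ## Killing one variable -/

section CommRing

variable {R : Type u} [CommRing R]

/-- **Kill the variable `X k`**: the `R`-algebra map `R[[X₀, X₁]] → R[[t]]` sending `X k ↦ 0` and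
the other variable to `t` (restriction to the axis `X k = 0`); Mathlib's `killCompl` along the
embedding `Function.Embedding.punit k.rev : Unit ↪ Fin 2`. [folklore] -/
def killVar (k : Fin 2) : MvPowerSeries (Fin 2) R →ₐ[R] PowerSeries R :=
  killCompl (Function.Embedding.punit k.rev)

/-- Coefficients of the restriction: `coeff tⁿ (killVar k f) = coeff (X_{k.rev})ⁿ f`. [folklore] -/
theorem coeff_killVar (k : Fin 2) (f : MvPowerSeries (Fin 2) R) (n : ℕ) :
    PowerSeries.coeff n (killVar k f) = coeff (Finsupp.single k.rev n) f := by
  rw [PowerSeries.coeff_def (s := Finsupp.single () n) Finsupp.single_eq_same, killVar,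
    coeff_killCompl, Finsupp.embDomain_single]
  rfl

/-- The constant coefficient is unchanged. [folklore] -/
theorem constantCoeff_killVar (k : Fin 2) (f : MvPowerSeries (Fin 2) R) :
    PowerSeries.constantCoeff (killVar k f) = constantCoeff f := by
  rw [← PowerSeries.coeff_zero_eq_constantCoeff_apply, coeff_killVar, Finsupp.single_zero,
    coeff_zero_eq_constantCoeff_apply]

/-- `killVar k (C a) = C a`. [folklore] -/
@[simp] theorem killVar_C (k : Fin 2) (a : R) : killVar k (C a) = PowerSeries.C a := by
  rw [killVar, killCompl_C]
  rfl

/-- `killVar k (X k) = 0`. [folklore] -/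
@[simp] theorem killVar_X_self (k : Fin 2) : killVar k (X k : MvPowerSeries (Fin 2) R) = 0 :=
  killCompl_X_eq_zero fun ⟨_, ha⟩ => fin2_rev_ne k ha

/-- `killVar k (X k.rev) = t`. [folklore] -/
@[simp] theorem killVar_X_rev (k : Fin 2) :
    killVar k (X k.rev : MvPowerSeries (Fin 2) R) = PowerSeries.X :=
  killCompl_X (R := R) (e := Function.Embedding.punit k.rev) ()

/-- `killVar 0 (X 1) = t`. [folklore] -/
@[simp] theorem killVar_zero_X_one : killVar 0 (X 1 : MvPowerSeries (Fin 2) R) = PowerSeries.X :=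
  killVar_X_rev 0

/-- `killVar 1 (X 0) = t`. [folklore] -/
@[simp] theorem killVar_one_X_zero : killVar 1 (X 0 : MvPowerSeries (Fin 2) R) = PowerSeries.X :=
  killVar_X_rev 1

/-- **The kernel of `killVar k` is `(X k)`**: a series restricts to zero on the axis `X k = 0` iff it
is divisible by `X k`. [folklore] -/
theorem killVar_eq_zero_iff (k : Fin 2) (f : MvPowerSeries (Fin 2) R) :
    killVar k f = 0 ↔ (X k : MvPowerSeries (Fin 2) R) ∣ f := by
  rw [X_dvd_iff, PowerSeries.ext_iff]
  simp only [map_zero, coeff_killVar]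
  constructor
  · intro h m hm
    have hm' : m k.rev.rev = 0 := by rwa [Fin.rev_rev]
    rw [finsupp_eq_single_of_rev_eq_zero hm']
    exact h _
  · intro h n
    exact h _ (by rw [Finsupp.single_eq_of_ne (fin2_rev_ne k).symm])

/-- A multiple of `X k` restricts to zero. [folklore] -/
theorem killVar_X_mul (k : Fin 2) (f : MvPowerSeries (Fin 2) R) : killVar k (X k * f) = 0 := by
  rw [map_mul, killVar_X_self, zero_mul]

/-- Embedding a one-variable series along the kept axis and restricting gives it back. [folklore] -/
theorem killVar_toMvPowerSeries (k : Fin 2) (g : PowerSeries R) :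
    killVar k (PowerSeries.toMvPowerSeries k.rev g) = g := by
  have h : PowerSeries.toMvPowerSeries k.rev g = rename (Function.Embedding.punit k.rev) g := rfl
  rw [h, killVar, killCompl_rename_app]

/-- A series involving only the kept variable (`coeff m f = 0` whenever `m k ≠ 0`) is the embedding
of its restriction. [folklore] -/
theorem toMvPowerSeries_killVar_of_forall_coeff_eq_zero (k : Fin 2) {f : MvPowerSeries (Fin 2) R}
    (hf : ∀ m : Fin 2 →₀ ℕ, m k ≠ 0 → coeff m f = 0) :
    PowerSeries.toMvPowerSeries k.rev (killVar k f) = f := by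
  have h : ∀ g : PowerSeries R, PowerSeries.toMvPowerSeries k.rev g = rename (Function.Embedding.punit k.rev) g :=
    fun _ => rfl
  ext m
  rw [h]
  by_cases hm : m k = 0
  · have hm' : m k.rev.rev = 0 := by rwa [Fin.rev_rev]
    have em : m = Finsupp.embDomain (Function.Embedding.punit k.rev) (Finsupp.single () (m k.rev)) := by
      rw [Finsupp.embDomain_single]
      exact finsupp_eq_single_of_rev_eq_zero hm'
    rw [em, coeff_embDomain_rename, killVar, coeff_killCompl]
  · rw [hf m hm, coeff_rename_eq_zero]
    rintro ⟨x, rfl⟩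
    exact hm (Finsupp.mapDomain_notin_range _ _ fun ⟨_, ha⟩ => fin2_rev_ne k ha)

/-! ## Characteristic -/

/-- Power series rings over a ring of characteristic `p` have characteristic `p` (a theorem, to be
introduced locally with `haveI`). [folklore] -/
theorem charP_mvPowerSeries (σ : Type*) (p : ℕ) [CharP R p] : CharP (MvPowerSeries σ R) p :=
  charP_of_injective_ringHom (f := (C : R →+* MvPowerSeries σ R)) C_injective p

/-- One-variable power series over a ring of characteristic `p` have characteristic `p`. [folklore] -/
theorem charP_powerSeries (p : ℕ) [CharP R p] : CharP (PowerSeries R) p :=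
  charP_mvPowerSeries (R := R) Unit p

/-! ## First-order coefficients: the Leibniz rule at the origin -/

/-- A first-order coefficient of a two-variable series is a first-order coefficient of a
restriction. [folklore] -/
theorem coeff_single_one_eq_coeff_killVar (k : Fin 2) (f : MvPowerSeries (Fin 2) R) :
    coeff (Finsupp.single k 1) f = PowerSeries.coeff 1 (killVar k.rev f) := by
  rw [coeff_killVar, Fin.rev_rev]

/-- **Leibniz rule at the origin**: `coeff_{X_k}(fg) = f(0)·coeff_{X_k}(g) + coeff_{X_k}(f)·g(0)`.
[folklore] -/
theorem coeff_single_one_mul (k : Fin 2) (f g : MvPowerSeries (Fin 2) R) :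
    coeff (Finsupp.single k 1) (f * g) =
      constantCoeff f * coeff (Finsupp.single k 1) g + coeff (Finsupp.single k 1) f * constantCoeff g := by
  simp only [coeff_single_one_eq_coeff_killVar, map_mul, PowerSeries.coeff_one_mul, constantCoeff_killVar]
  ring

/-- First-order coefficients of powers: `coeff_{X_k}(fⁿ⁺¹) = (n+1) f(0)ⁿ coeff_{X_k}(f)`. [folklore] -/
theorem coeff_single_one_pow_succ (k : Fin 2) (f : MvPowerSeries (Fin 2) R) (n : ℕ) :
    coeff (Finsupp.single k 1) (f ^ (n + 1)) =
      ((n : R) + 1) * constantCoeff f ^ n * coeff (Finsupp.single k 1) f := by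
  induction n with
  | zero => simp
  | succ n ih =>
    rw [pow_succ, coeff_single_one_mul, ih, map_pow]
    push_cast
    ring

/-- **In characteristic `p`, `p`-th powers have no first-order terms.** [folklore] -/
theorem coeff_single_one_pow_eq_zero (p : ℕ) [hp : Fact p.Prime] [CharP R p] (k : Fin 2)
    (f : MvPowerSeries (Fin 2) R) : coeff (Finsupp.single k 1) (f ^ p) = 0 := by
  obtain ⟨n, hn⟩ : ∃ n, p = n + 1 := ⟨p - 1, (Nat.succ_pred_eq_of_pos hp.out.pos).symm⟩
  have h0 : ((n : R) + 1) = 0 := by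
    have : ((p : ℕ) : R) = 0 := CharP.cast_eq_zero R p
    rw [hn] at this
    push_cast at this
    exact this
  rw [hn, coeff_single_one_pow_succ, h0, zero_mul, zero_mul]

/-! ### First-order coefficients of `C a`, `X j`, and `X j * f` -/

/-- `coeff_{X_k}(C a) = 0`. [folklore] -/
theorem coeff_single_one_C (k : Fin 2) (a : R) :
    coeff (Finsupp.single k 1) (C a : MvPowerSeries (Fin 2) R) = 0 := by
  rw [coeff_C, if_neg (Finsupp.single_ne_zero.mpr one_ne_zero)]

/-- `coeff_{X_k}(X_k) = 1`. [folklore] -/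
theorem coeff_single_one_X_self (k : Fin 2) :
    coeff (Finsupp.single k 1) (X k : MvPowerSeries (Fin 2) R) = 1 := by
  rw [coeff_X, if_pos rfl]

/-- `coeff_{X_k}(X_{k.rev}) = 0`. [folklore] -/
theorem coeff_single_one_X_rev (k : Fin 2) :
    coeff (Finsupp.single k 1) (X k.rev : MvPowerSeries (Fin 2) R) = 0 := by
  classical
  rw [coeff_X, if_neg]
  intro h
  have := congrArg (fun m : Fin 2 →₀ ℕ => m k) h
  simp [fin2_rev_ne k] at this

/-- `coeff_{X_k}(X_k · f) = f(0)`. [folklore] -/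
theorem coeff_single_one_X_mul (k : Fin 2) (f : MvPowerSeries (Fin 2) R) :
    coeff (Finsupp.single k 1) (X k * f) = constantCoeff f := by
  rw [coeff_single_one_mul, constantCoeff_X, coeff_single_one_X_self, zero_mul, one_mul, zero_add]

/-- `coeff_{X_k}(X_{k.rev} · f) = 0`. [folklore] -/
theorem coeff_single_one_X_rev_mul (k : Fin 2) (f : MvPowerSeries (Fin 2) R) :
    coeff (Finsupp.single k 1) (X k.rev * f) = 0 := by
  rw [coeff_single_one_mul, constantCoeff_X, coeff_single_one_X_rev, zero_mul, zero_mul, zero_add]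

/-- `coeff_{X_k}` vanishes on any positive power of the other variable times anything. [folklore] -/
theorem coeff_single_one_X_rev_pow_mul (k : Fin 2) {n : ℕ} (hn : n ≠ 0) (f : MvPowerSeries (Fin 2) R) :
    coeff (Finsupp.single k 1) (X k.rev ^ n * f) = 0 := by
  obtain ⟨m, rfl⟩ := Nat.exists_eq_succ_of_ne_zero hn
  rw [pow_succ, mul_assoc, mul_comm (X k.rev ^ m), mul_assoc, coeff_single_one_X_rev_mul]

end CommRing

/-! ## Cancellation of variables against divisors -/

section Field

variable {F : Type u} [Field F]

/-- `F[[X₀, X₁]]` is a domain (a theorem; use `haveI`). [folklore] -/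
theorem isDomain_mvPowerSeries (σ : Type*) : IsDomain (MvPowerSeries σ F) :=
  NoZeroDivisors.to_isDomain _

/-- A variable is nonzero. [folklore] -/
theorem X_ne_zero' (k : Fin 2) : (X k : MvPowerSeries (Fin 2) F) ≠ 0 := by
  intro h
  have := congrArg (coeff (Finsupp.single k 1)) h
  rw [coeff_single_one_X_self, map_zero] at this
  exact one_ne_zero this

/-- **Cancelling a variable**: if `w` does not vanish on the axis `X k = 0` and `w ∣ X k · g`, then
`w ∣ g`. [folklore] -/
theorem dvd_of_dvd_X_mul {k : Fin 2} {w g : MvPowerSeries (Fin 2) F} (hw : killVar k w ≠ 0)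
    (h : w ∣ X k * g) : w ∣ g := by
  haveI := isDomain_mvPowerSeries (F := F) (Fin 2)
  obtain ⟨q, hq⟩ := h
  have hq0 : killVar k q = 0 := by
    have h1 := congrArg (killVar k) hq
    rw [killVar_X_mul, map_mul] at h1
    exact (mul_eq_zero.mp h1.symm).resolve_left hw
  obtain ⟨q', rfl⟩ := (killVar_eq_zero_iff k q).mp hq0
  refine ⟨q', mul_left_cancel₀ (X_ne_zero' k) ?_⟩
  rw [hq]
  ring

/-- Cancelling a power of a variable. [folklore] -/
theorem dvd_of_dvd_X_pow_mul {k : Fin 2} {w g : MvPowerSeries (Fin 2) F} (hw : killVar k w ≠ 0)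
    (n : ℕ) (h : w ∣ X k ^ n * g) : w ∣ g := by
  induction n generalizing g with
  | zero => simpa using h
  | succ n ih =>
    have e : (X k : MvPowerSeries (Fin 2) F) ^ (n + 1) * g = X k ^ n * (X k * g) := by ring
    rw [e] at h
    exact dvd_of_dvd_X_mul hw (ih h)

/-- A series with zero constant term is not a unit. [folklore] -/
theorem not_isUnit_of_constantCoeff_eq_zero {w : MvPowerSeries (Fin 2) F} (h0 : constantCoeff w = 0) :
    ¬ IsUnit w := by
  rw [isUnit_iff_constantCoeff, h0]
  exact not_isUnit_zero

/-- **Lemma A″ (no monomial multiples)**: a non-unit `w` whose restrictions to both axes are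
nonzero divides no `X₀ᵃ · X₁ᵇ · U` with `U` a unit. [folklore] -/
theorem not_dvd_X_pow_mul_X_pow_mul {w : MvPowerSeries (Fin 2) F} (h0 : constantCoeff w = 0)
    (hX : killVar 0 w ≠ 0) (hY : killVar 1 w ≠ 0) {U : MvPowerSeries (Fin 2) F} (hU : IsUnit U)
    (a b : ℕ) : ¬ w ∣ X 0 ^ a * X 1 ^ b * U := by
  intro h
  rw [mul_assoc] at h
  exact not_isUnit_of_constantCoeff_eq_zero h0
    (isUnit_of_dvd_unit (dvd_of_dvd_X_pow_mul hY b (dvd_of_dvd_X_pow_mul hX a h)) hU)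

/-- **Lemma A (one variable)**: a non-unit `w` not vanishing on the axis `X k = 0` divides no
`X_kᵃ · U` with `U` a unit. [folklore] -/
theorem not_dvd_X_pow_mul {k : Fin 2} {w : MvPowerSeries (Fin 2) F} (h0 : constantCoeff w = 0)
    (hk : killVar k w ≠ 0) {U : MvPowerSeries (Fin 2) F} (hU : IsUnit U) (a : ℕ) :
    ¬ w ∣ X k ^ a * U := fun h =>
  not_isUnit_of_constantCoeff_eq_zero h0 (isUnit_of_dvd_unit (dvd_of_dvd_X_pow_mul hk a h) hU)

/-- A series with nonzero constant term is a unit. [folklore] -/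
theorem isUnit_of_constantCoeff_ne_zero {r : MvPowerSeries (Fin 2) F}
    (hr : constantCoeff r ≠ 0) : IsUnit r :=
  (isUnit_iff_constantCoeff).mpr (isUnit_iff_ne_zero.mpr hr)

end Field

/-! ## Leading forms and line forms (definitions) -/

section LeadingForm

variable {F : Type u} [Field F]

open Finsupp

/-- **The leading form** `L(f)`: the homogeneous component of `f` of degree `ord f` (and `0` for
`f = 0`). [cite: Cutkosky2014, §3 (proof of Lemma 3.1)] -/
def leadingForm (f : MvPowerSeries (Fin 2) F) : MvPowerSeries (Fin 2) F :=
  homogeneousComponent f.order.toNat f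

/-- `L(0) = 0`. [folklore] -/
@[simp] theorem leadingForm_zero : leadingForm (0 : MvPowerSeries (Fin 2) F) = 0 := by
  simp [leadingForm]

/-- For `f ≠ 0` the order is finite: `↑(ord f).toNat = ord f`. [folklore] -/
theorem order_toNat_eq {f : MvPowerSeries (Fin 2) F} (hf : f ≠ 0) : (f.order.toNat : ℕ∞) = f.order :=
  ne_zero_iff_order_finite.mp hf

/-- **The leading form of a nonzero series is nonzero.** [folklore] -/
theorem leadingForm_ne_zero {f : MvPowerSeries (Fin 2) F} (hf : f ≠ 0) : leadingForm f ≠ 0 :=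
  homogeneousComponent_of_order (order_toNat_eq hf)

/-- The leading form is homogeneous of degree `ord f`. [folklore] -/
theorem isHomogeneous_leadingForm (f : MvPowerSeries (Fin 2) F) :
    IsHomogeneous (leadingForm f) f.order.toNat :=
  isHomogeneous_homogeneousComponent f _

/-- Coefficients of the leading form: those of `f` in degree `ord f`. [folklore] -/
theorem coeff_leadingForm (f : MvPowerSeries (Fin 2) F) (d : Fin 2 →₀ ℕ) :
    coeff d (leadingForm f) = if degree d = f.order.toNat then coeff d f else 0 :=
  coeff_homogeneousComponent _ d f

/-- The weights `(ord q₀, ord q₁)` (junk value `0` at a zero series, whose order is `⊤`; the theory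
only uses nonzero `qᵢ`). [folklore] -/
def wt (q : Fin 2 → MvPowerSeries (Fin 2) F) : Fin 2 → ℕ := fun i => (q i).order.toNat

/-- The weight of an exponent `(j, k)` is `n₀ j + n₁ k`. [folklore] -/
theorem weight_wt_eq (q : Fin 2 → MvPowerSeries (Fin 2) F) (e : Fin 2 →₀ ℕ) :
    weight (wt q) e = e 0 * wt q 0 + e 1 * wt q 1 := by
  rw [weight_apply, Finsupp.sum_fintype _ _ (fun i => by simp), Fin.sum_univ_two]
  rfl

/-- **The line form** of `h` in weighted degree `d`: `Σ_{wt(j,k) = d} h_{jk} L(q₀)ʲ L(q₁)ᵏ`, i.e.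
the weighted-homogeneous component of `h` of weight `d` evaluated at the leading forms
(`lineForm_eq_aeval_weightedHomogeneousComponent`). [folklore] -/
def lineForm (q : Fin 2 → MvPowerSeries (Fin 2) F) (h : MvPolynomial (Fin 2) F) (d : ℕ) :
    MvPowerSeries (Fin 2) F :=
  ∑ e ∈ h.support with weight (wt q) e = d,
    C (MvPolynomial.coeff e h) * (leadingForm (q 0) ^ e 0 * leadingForm (q 1) ^ e 1)

/-- Evaluating a monomial `c·Uʲ Vᵏ` at a pair of series. [folklore] -/
theorem aeval_monomial_fin2 (g : Fin 2 → MvPowerSeries (Fin 2) F) (e : Fin 2 →₀ ℕ) (c : F) :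
    MvPolynomial.aeval g (MvPolynomial.monomial e c) = C c * (g 0 ^ e 0 * g 1 ^ e 1) := by
  rw [MvPolynomial.aeval_monomial, Finsupp.prod_fintype _ _ (fun i => pow_zero (g i)), Fin.prod_univ_two]
  rfl

/-- Bridge to Mathlib's weighted-homogeneous API: the line form is the weight-`d` component of `h`
(weights `wt q`) evaluated at the leading forms `(L(q₀), L(q₁))`. [folklore] -/
theorem lineForm_eq_aeval_weightedHomogeneousComponent (q : Fin 2 → MvPowerSeries (Fin 2) F)
    (h : MvPolynomial (Fin 2) F) (d : ℕ) :
    lineForm q h d = MvPolynomial.aeval (fun i => leadingForm (q i))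
      (MvPolynomial.weightedHomogeneousComponent (wt q) d h) := by
  classical
  rw [MvPolynomial.weightedHomogeneousComponent_apply, map_sum, lineForm]
  refine Finset.sum_congr rfl fun e _ => ?_
  rw [aeval_monomial_fin2]

end LeadingForm

end Literature.RingTheory.TwoVariableSeries
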